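import Literature.Barriers.SmoothPoincare4.ExoticContractibleUniverseProofs
import HarnessLib

/-!
# Akbulut's smooth leaf from an effective involutive cork twist

Third sibling proof file of `Literature/Barriers/SmoothPoincare4/ExoticContractible.lean`, next to
`ExoticContractibleProofs.lean` — which states the named fact
`Literature.Barriers.SmoothPoincare4.akbulut1991_notExtendsToDiffeomorph` (a compact contractible
smooth 4-manifold `W` with an INVOLUTION `τ` of `∂W` that is the restriction of no
self-diffeomorphism of `W`; Akbulut 1991, Thm. 2 = Akbulut–Yasui 2008, Lemma 2.8 (1)) and proves
that, modulo Freedman–Quinn, it is exactly the existence of a cork in the tree's sense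
(`akbulut1991_notExtendsToDiffeomorph_iff_exists_isCork`) — and to
`ExoticContractibleCorkTheoremProofs.lean`, which obtains the NON-involutive content of a cork
(the fact `akbulut1991_mazurCork`, no involutivity) from the Donaldson exotic h-cobordant pair,
Matveyev's cork decomposition theorem and uniqueness of gluings. Fact seat
`provefact-Literature.Barriers.SmoothPoincare4.akbu-7eddea9c06` (2026-08-15).

## Status of the fact

Every printed proof of the fact is gauge-theoretic: Akbulut 1991 (Donaldson invariants: "`α` is
not slice in `W`"), Akbulut–Yasui 2008, proof of Lemma 2.8 ("every compact Stein manifold can be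
embedded into a minimal symplectic 4-manifold (e.g. [LM])", so `W¹_n ⊃ W_n` "has no 2-sphere with
self intersection number `-1`. But clearly `W²_n`", the twist of `W¹_n` along `f_n`, "contains a
2-sphere with self intersection number `-1`"); it needs moreover the Mazur manifold `W₁` and the
2-handlebodies `W¹_n`, `W²_n` as smooth manifolds with boundary (Kirby calculus). Neither an
exotic-structure detector (Donaldson / Seiberg–Witten / Heegaard Floer) nor handlebody
constructions exist in Mathlib or `Literature/`; the discharge
`akbulut1991_notExtendsToDiffeomorph_holds` is not attempted (triage XL), and no named fact of
the tree implies the fact (the cork-theorem route of `ExoticContractibleCorkTheoremProofs.lean`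
and Kang's Thm. 1.1 of `OneStabilisationContractibleCorkProofs.lean` both lack involutivity).

What this file proves is how the fact sits on the OTHER printed route to corks, the cork
theorem WITH INVOLUTION:

> Akbulut–Yasui 2008 (arXiv:0806.3010), Thm. 1.1 ([M], [C], [AM2]): "For every homeomorphic but
> non-diffeomorphic pair of simply connected closed 4-manifolds, one is obtained from the other
> by removing a contractible 4-manifold and gluing it via an involution on the boundary. Such a
> contractible 4-manifold has since been called a Cork. Furthermore, corks and their complements
> can always be made compact Stein 4-manifolds."; Def. 2.1: "A cork `(C, τ)` is called a cork of
> a smooth 4-manifold `X`, if `C ⊂ X` and `X` changes its diffeomorphism type when removing `C`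
> and re-gluing it via `τ`."

* `not_extendsToDiffeomorph_of_isBoundaryGluing_of_isEmpty` — **proved**: if `X = C ∪_φ W` and
  `X' = C ∪_{φ ∘ τ} W` are gluings of compact smooth 4-manifolds with boundary along `∂C ≅ ∂W`
  and `X ≇ X'`, then `τ` extends to no self-diffeomorphism of `C`. This is
  `not_extendsToDiffeomorph_of_isEmpty_diffeomorph` of `ExoticContractibleCorkTheoremProofs.lean`
  with its gluing-uniqueness hypothesis `hU` (Hirsch 1976, Ch. 8 §2, Thm. 2.1) DISCHARGED by the
  tree's theorem `Literature.Topology.FourManifolds.nonempty_diffeomorph_of_isBoundaryGluing_holds`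
  (`GluingProofs.lean`), i.e. now unconditional.
* `akbulut1991_notExtendsToDiffeomorph_of_involutive_isBoundaryGluing` — **proved**: if moreover
  `C` is contractible and `τ` is an involution — `(C, τ)` is "a cork of `X`" in the sense of
  Def. 2.1, Stein structure aside — then `(C, ∂C, τ)` witnesses the fact (at the universe of the
  data).
* `akbulut1991_notExtendsToDiffeomorph_of_involutiveCorkTheorem` — **proved**: Thm. 1.1 rendered
  in the tree's gluing vocabulary for h-cobordant pairs (hypothesis `hT`, next section) and the
  Donaldson–Freedman–Wall exotic h-cobordant pair (the tree's named fact
  `Literature.Topology.FourManifolds.exists_isHCobordant_isEmpty_diffeomorph_four`, hypothesis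
  `hD`) give the fact at EVERY universe (a witness in `Type`, lifted by
  `akbulut1991_notExtendsToDiffeomorph_of_universe_zero`).

Resulting dependency graph (all arrows proved in the tree):
`akbulut1991_notExtendsToDiffeomorph.{u} ⇐ hT ∧ exists_isHCobordant_isEmpty_diffeomorph_four`,
beside the existing `akbulut1991_mazurCork.{u} ⇐ Matveyev1996_decomposition ∧
exists_isHCobordant_isEmpty_diffeomorph_four ∧ freedmanQuinn1990_homeomorph_extends_contractible`
(`akbulut1991_mazurCork_of_matveyev_donaldson_freedmanQuinn`). No named fact is introduced.

## The hypothesis `hT` (Thm. 1.1 in tree vocabulary; NOT a named fact)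

`hT` is Thm. 1.1 minus its Stein clause, for h-cobordant pairs, in the shape of the tree's
`Literature.Topology.FourManifolds.corkDecomposition` (`CorkTwist.lean`: "`X₁ = C ∪_φ W`,
`X₂ = C ∪_{φ ∘ τ} W` for a compact contractible `C` and a self-diffeomorphism `τ` of `∂C`") with
two differences: the boundary map `τ` is an INVOLUTION (the refinement `corkDecomposition`
explicitly omits: "The refinements that `τ` can be chosen to be an involution and `C` Stein
(Akbulut–Matveyev 1998) ... are not part of this statement"), and the common exterior `W` is
exposed together with its instances (Hausdorff, second countable, `C^∞`, compact — in print
`W = X₁ ∖ int C`) rather than hidden in `Literature.Topology.FourManifolds.IsCorkTwist`, which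
records on `W` only a topology, a half-space atlas and a boundary datum, not enough to invoke
uniqueness of gluings. On "h-cobordant" for "homeomorphic": the sources [M] = Matveyev 1996 and
[C] = Curtis–Freedman–Hsiang–Stong 1996 are theorems about h-cobordisms, and for simply
connected closed smooth 4-manifolds the two hypotheses agree (Wall; Freedman), as the docstring
of `corkDecomposition` records; the tree's exotic pair is stated h-cobordant. `hT` is kept a
hypothesis: this seat proves and does not mint facts (D-0026). Were Thm. 1.1 vendored in this
shape and discharged, `akbulut1991_notExtendsToDiffeomorph_of_involutiveCorkTheorem` would reduce
the leaf to Donaldson's theorem alone.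

## References

[AkbulutYasui2008] [Akbulut1991Fake] [Matveyev1996] [CurtisFreedmanHsiangStong1996]
[AkbulutMatveyev1998] [HirschDT1976] [DonaldsonIrrationality1987]
-/

noncomputable section

open scoped Manifold ContDiff
open Function Literature.Topology.FourManifolds

namespace Literature.Barriers.SmoothPoincare4

universe u

/-! ### An effective twist has a non-extending boundary map (now unconditional) -/

section Effective

variable {C W : Type u} [TopologicalSpace C] [T2Space C] [SecondCountableTopology C]
  [ChartedSpace (EuclideanHalfSpace 4) C] [IsManifold (𝓡∂ 4) ∞ C] [CompactSpace C]
  [TopologicalSpace W] [T2Space W] [SecondCountableTopology W]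
  [ChartedSpace (EuclideanHalfSpace 4) W] [IsManifold (𝓡∂ 4) ∞ W] [CompactSpace W]
  {bC : BoundaryData (𝓡∂ 4) C (𝓡 3)} {bW : BoundaryData (𝓡∂ 4) W (𝓡 3)}
  {τ : bC.carrier ≃ₘ⟮𝓡 3, 𝓡 3⟯ bC.carrier} {φ : bC.carrier ≃ₘ⟮𝓡 3, 𝓡 3⟯ bW.carrier}
  {X X' : Type u}
  [TopologicalSpace X] [ChartedSpace (EuclideanSpace ℝ (Fin 4)) X] [IsManifold (𝓡 4) ∞ X]
  [TopologicalSpace X'] [ChartedSpace (EuclideanSpace ℝ (Fin 4)) X'] [IsManifold (𝓡 4) ∞ X']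

/-- **A twist that changes the diffeomorphism type has a non-extending boundary map
(unconditional form).** Let `X = C ∪_φ W` and `X' = C ∪_{φ ∘ τ} W` be gluings of compact
(Hausdorff, second countable) smooth 4-manifolds with boundary `C`, `W` along a boundary
identification `φ : ∂C ≅ ∂W` and its twist by a self-diffeomorphism `τ` of `∂C`. If `X` and `X'`
are not diffeomorphic, then `τ` is the restriction of no self-diffeomorphism of `C`: an
extension `G` would present `X` too as a gluing along `φ ∘ τ` (transport along `G`), whence
`X ≅ X'` by uniqueness of gluings. This is `not_extendsToDiffeomorph_of_isEmpty_diffeomorph`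
with its hypothesis `hU` supplied by the tree's theorem
`Literature.Topology.FourManifolds.nonempty_diffeomorph_of_isBoundaryGluing_holds` (Hirsch, Ch. 8
§2, Thm. 2.1). It is the reason a cork "of `X`" (Akbulut–Yasui 2008, Def. 2.1: "`X` changes its
diffeomorphism type when removing `C` and re-gluing it via `τ`") is in particular a cork
("cannot extend to any self-diffeomorphism of `C`").
[cite: HirschDT1976, Ch. 8 §2, Thm. 2.1] [cite: AkbulutYasui2008, Def. 2.1 (arXiv:0806.3010 §2 numbering)] -/
theorem not_extendsToDiffeomorph_of_isBoundaryGluing_of_isEmpty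
    (hX : IsBoundaryGluing bC bW φ (𝓡 4) X) (hX' : IsBoundaryGluing bC bW (τ.trans φ) (𝓡 4) X')
    (hne : IsEmpty (X ≃ₘ⟮𝓡 4, 𝓡 4⟯ X')) : ¬ ExtendsToDiffeomorph bC τ :=
  not_extendsToDiffeomorph_of_isEmpty_diffeomorph
    nonempty_diffeomorph_of_isBoundaryGluing_holds hX hX' hne

/-- **An effective involutive cork twist witnesses Akbulut's smooth leaf.** If `C` is moreover
contractible and `τ` is an involution of `∂C` — so that, Stein structure aside, `(C, τ)` is a
cork of `X = C ∪_φ W` in the sense of Akbulut–Yasui 2008, Def. 2.1, `X' = C ∪_{φ ∘ τ} W ≇ X`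
being its cork twist — then `(C, ∂C, τ)` is a witness of
`akbulut1991_notExtendsToDiffeomorph` at the universe of the data: a compact (Hausdorff, second
countable) contractible smooth 4-manifold with a boundary involution extending to no
self-diffeomorphism (`not_extendsToDiffeomorph_of_isBoundaryGluing_of_isEmpty`). By Thm. 1.1 of
loc. cit. ([M], [C], [AM2]) every homeomorphic, non-diffeomorphic pair of simply connected
closed smooth 4-manifolds arises this way.
[cite: AkbulutYasui2008, Def. 2.1 and Thm. 1.1 (arXiv:0806.3010 numbering)] [cite: HirschDT1976, Ch. 8 §2, Thm. 2.1] -/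
theorem akbulut1991_notExtendsToDiffeomorph_of_involutive_isBoundaryGluing [ContractibleSpace C]
    (hτ : Involutive τ)
    (hX : IsBoundaryGluing bC bW φ (𝓡 4) X) (hX' : IsBoundaryGluing bC bW (τ.trans φ) (𝓡 4) X')
    (hne : IsEmpty (X ≃ₘ⟮𝓡 4, 𝓡 4⟯ X')) : akbulut1991_notExtendsToDiffeomorph.{u} :=
  ⟨C, ‹_›, ‹_›, ‹_›, ‹_›, ‹_›, ‹_›, ‹_›, bC, τ, hτ,
    not_extendsToDiffeomorph_of_isBoundaryGluing_of_isEmpty hX hX' hne⟩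

end Effective

/-! ### The leaf from the cork theorem with involution and the Donaldson pair -/

/-- **Akbulut's smooth leaf, at every universe, from the cork theorem with involution and the
exotic h-cobordant pair.** Hypothesis `hT` is Akbulut–Yasui 2008, Thm. 1.1 ("For every
homeomorphic but non-diffeomorphic pair of simply connected closed 4-manifolds, one is obtained
from the other by removing a contractible 4-manifold and gluing it via an involution on the
boundary", proved in [M] = Matveyev 1996 and [C] = Curtis–Freedman–Hsiang–Stong 1996 for
h-cobordant pairs, strengthened in [AM2] = Akbulut–Matveyev 1998) rendered in the tree's gluing
vocabulary, Stein clause dropped, for h-cobordant simply connected closed smooth 4-manifolds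
`X₁`, `X₂`: there are a compact contractible smooth `C`, a compact smooth exterior `W`, boundary
data, an INVOLUTION `τ` of `∂C` and `φ : ∂C ≅ ∂W` with `X₁ = C ∪_φ W` and `X₂ = C ∪_{φ ∘ τ} W`
(the shape of `Literature.Topology.FourManifolds.corkDecomposition` with involutivity added and
the exterior's instances exposed; NOT a named fact of the tree — see the module docstring).
Hypothesis `hD` is the tree's named fact
`Literature.Topology.FourManifolds.exists_isHCobordant_isEmpty_diffeomorph_four` (Donaldson 1987
with Freedman and Wall: h-cobordant, non-diffeomorphic simply connected closed smooth `M`, `N`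
exist). Apply `hT` to the pair of `hD`; the resulting involutive twist is effective, so
`akbulut1991_notExtendsToDiffeomorph_of_involutive_isBoundaryGluing` gives a witness in `Type`,
lifted to universe `u` by `akbulut1991_notExtendsToDiffeomorph_of_universe_zero`.
[cite: AkbulutYasui2008, Thm. 1.1 and Def. 2.1 (arXiv:0806.3010 numbering)] [cite: Matveyev1996, Theorem] [cite: DonaldsonIrrationality1987, p. 142] -/
theorem akbulut1991_notExtendsToDiffeomorph_of_involutiveCorkTheorem
    (hT : ∀ (X₁ X₂ : Type) [TopologicalSpace X₁] [T2Space X₁] [SecondCountableTopology X₁]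
        [ChartedSpace (EuclideanSpace ℝ (Fin 4)) X₁] [IsManifold (𝓡 4) ∞ X₁] [CompactSpace X₁]
        [SimplyConnectedSpace X₁]
        [TopologicalSpace X₂] [T2Space X₂] [SecondCountableTopology X₂]
        [ChartedSpace (EuclideanSpace ℝ (Fin 4)) X₂] [IsManifold (𝓡 4) ∞ X₂] [CompactSpace X₂]
        [SimplyConnectedSpace X₂],
        IsHCobordant 4 X₁ X₂ →
        ∃ (C : Type) (_ : TopologicalSpace C) (_ : T2Space C) (_ : SecondCountableTopology C)
          (_ : ChartedSpace (EuclideanHalfSpace 4) C) (_ : IsManifold (𝓡∂ 4) ∞ C)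
          (_ : CompactSpace C) (_ : ContractibleSpace C)
          (W : Type) (_ : TopologicalSpace W) (_ : T2Space W) (_ : SecondCountableTopology W)
          (_ : ChartedSpace (EuclideanHalfSpace 4) W) (_ : IsManifold (𝓡∂ 4) ∞ W)
          (_ : CompactSpace W)
          (bC : BoundaryData (𝓡∂ 4) C (𝓡 3)) (bW : BoundaryData (𝓡∂ 4) W (𝓡 3))
          (τ : bC.carrier ≃ₘ⟮𝓡 3, 𝓡 3⟯ bC.carrier) (φ : bC.carrier ≃ₘ⟮𝓡 3, 𝓡 3⟯ bW.carrier),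
          Involutive τ ∧ IsBoundaryGluing bC bW φ (𝓡 4) X₁ ∧
            IsBoundaryGluing bC bW (τ.trans φ) (𝓡 4) X₂)
    (hD : exists_isHCobordant_isEmpty_diffeomorph_four) :
    akbulut1991_notExtendsToDiffeomorph.{u} := by
  obtain ⟨M, N, _, _, _, _, _, _, _, _, _, _, _, _, _, _, hH, hne⟩ := hD
  obtain ⟨C, _, _, _, _, _, _, _, W, _, _, _, _, _, _, bC, bW, τ, φ, hτ, hX, hX'⟩ := hT M N hH
  exact akbulut1991_notExtendsToDiffeomorph_of_universe_zero
    (akbulut1991_notExtendsToDiffeomorph_of_involutive_isBoundaryGluing hτ hX hX' hne)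

end Literature.Barriers.SmoothPoincare4

end
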